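import Literature.NumberTheory.LFunctions.Zhang2022.ObjectiveTwinDetTwoTerm

/-!
# Zhang (2022) design-space objective, twin part 18d: the `m = ¼` EDGE family `b = (1, J−¼, J+¼)` for EVERY `J`

Y. Zhang, *Discrete mean estimates and the Landau–Siegel zero*, arXiv:2211.02515v1 (2022)
[Zhang2022LandauSiegel] — an unrefereed manuscript under adjudication. **This file SEARCHES and TYPES; it
makes no claim about Landau–Siegel zeros, about Theorems 1–2 of the manuscript, or about a repaired (2.32),
until a kernel theorem says so.** LANDAU–SIEGEL programme, cell `landau-siegel`, §A Lean twin serving §D (edge ell):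
companion of part 18c (`ObjectiveTwinDetFullGapLimit`, the full-gap family `(1, J−½, J+½)`). ls-Bmulti-num-1 g4
(cell INBOX 2026-08-27T01:20:50Z) also tabulated the `m = ¼` edge family `b = (1, J−¼, J+¼)` on the witness
`u_J = k₁ + (−1)^J k_J`: `−2.28481874854634` (`J = 5`), `−2.28230322642314` (`J = 20`); part 16 has `J = 3`
(`−(95√2/378)π − 2288/567 + 1144√2/567`). Here, for every `J`:

* `Det.shiftW_quarterGap` — `W(1, J−¼, J+¼)` symbolic in `J` (phases `−i(−1)^J`, `e^{3πi/4}`, `e^{πi/4}`);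
* `Det.formDet_quarterGapEdge_even` — `J` even `≥ 2`:
  `FormDet = −4 + 2√2 − (√2/4)·π·(1 + 1/(J(4J−5)(4J−3)))`;
* `Det.formDet_quarterGapEdge_odd` — `J` odd `≥ 3`:
  `FormDet = (−4 + 2√2)(1 + (2J−1)/(J²(4J−5)(4J−3))) − (√2/4)·π·(1 + 1/(J(4J−5)(4J−3)))`;
so the values tend to `−4 + 2√2 − √2π/4 = −2.28229…`.
With part 18c: for far-pair half-width `w ∈ {½, ¼}` the edge value reads `A_w(1 + [J odd](2J−1)w²/(J²(J−1−w)(J−1+w)))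
+ B_w(1 + w²/(J(J−1−w)(J−1+w)))` with `(A_½, B_½) = (−4, −π)`, `(A_¼, B_¼) = (−4 + 2√2, −√2π/4)` (an observation on
the two typed families, not a theorem about general `w`). SCOPE: `b₀ = 1` is the INADMISSIBLE edge.
Theorems only; no new definitions.
-/

noncomputable section

open Complex Real ComplexConjugate Filter Topology

namespace Literature.NumberTheory.LFunctions.Zhang2022

namespace Det

open Repair Objective

/-! ## Helpers -/

/-- `x / c_j = x·(1/(jπ))·i`. [folklore] -/
private theorem div_afeFreq₁₈d (x : ℂ) {j : ℕ} (hj : j ≠ 0) :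
    x / afeFreq j = x * (((1 / (j * π)) : ℝ) : ℂ) * Complex.I := by
  have hc := afeFreq_ne_zero hj
  rw [div_eq_iff hc]
  unfold afeFreq
  push_cast
  have hπ : (π : ℂ) ≠ 0 := Complex.ofReal_ne_zero.mpr Real.pi_ne_zero
  have hjc : (j : ℂ) ≠ 0 := Nat.cast_ne_zero.mpr hj
  field_simp
  ring_nf
  rw [Complex.I_sq]
  ring

/-- `1/c_j = (1/(jπ))·i`. [folklore] -/
private theorem afeFreq_inv₁₈d {j : ℕ} (hj : j ≠ 0) :
    (afeFreq j)⁻¹ = (((1 / (j * π)) : ℝ) : ℂ) * Complex.I := by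
  rw [inv_eq_one_div, div_afeFreq₁₈d 1 hj, one_mul]

/-- `c_j = −(jπ)·i`. [folklore] -/
private theorem afeFreq_eq₁₈d (j : ℕ) : afeFreq j = ((-(j * π) : ℝ) : ℂ) * Complex.I := by
  unfold afeFreq; push_cast; ring

/-- `e^{iπ(J − ½)} = −i·(−1)^J`. [folklore] -/
private theorem cexp_pi_mul_sub_half' (J : ℕ) :
    cexp (I * π * (((J : ℝ) - 1 / 2 : ℝ) : ℂ)) = -I * (-1) ^ J := by
  rw [show I * π * (((J : ℝ) - 1 / 2 : ℝ) : ℂ) = (J : ℂ) * (π * I) + (-(π / 2) : ℂ) * I by push_cast; ring,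
    Complex.exp_add, Complex.exp_nat_mul, Complex.exp_pi_mul_I, Complex.exp_mul_I, Complex.cos_neg, Complex.sin_neg,
    Complex.cos_pi_div_two, Complex.sin_pi_div_two]
  ring

/-- `e^{3πi/4} = (−√2 + i√2)/2`. [folklore] -/
private theorem cexp_three_quarters :
    cexp (I * π * ((3 / 4 : ℝ) : ℂ)) = ((-(Real.sqrt 2 / 2) : ℝ) : ℂ) + ((Real.sqrt 2 / 2 : ℝ) : ℂ) * I := by
  have hc : Real.cos (3 * π / 4) = -(Real.sqrt 2 / 2) := by
    rw [show 3 * π / 4 = π - π / 4 by ring, Real.cos_pi_sub, Real.cos_pi_div_four]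
  have hs : Real.sin (3 * π / 4) = Real.sqrt 2 / 2 := by
    rw [show 3 * π / 4 = π - π / 4 by ring, Real.sin_pi_sub, Real.sin_pi_div_four]
  rw [show I * π * ((3 / 4 : ℝ) : ℂ) = ((3 * π / 4 : ℝ) : ℂ) * I by push_cast; ring,
    Complex.exp_mul_I, ← Complex.ofReal_cos, ← Complex.ofReal_sin, hc, hs]

/-- `e^{πi/4} = (√2 + i√2)/2`. [folklore] -/
private theorem cexp_quarter :
    cexp (I * π * ((1 / 4 : ℝ) : ℂ)) = ((Real.sqrt 2 / 2 : ℝ) : ℂ) + ((Real.sqrt 2 / 2 : ℝ) : ℂ) * I := by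
  rw [show I * π * ((1 / 4 : ℝ) : ℂ) = ((π / 4 : ℝ) : ℂ) * I by push_cast; ring,
    Complex.exp_mul_I, ← Complex.ofReal_cos, ← Complex.ofReal_sin, Real.cos_pi_div_four, Real.sin_pi_div_four]

/-! ## The recipe `shiftRecipe (1, J−¼, J+¼)` in closed form -/

/-- `s(1, J−¼, J+¼) = (2J, J+5/4, J+3/4)`. [cite: Zhang2022LandauSiegel, §8 (8.13)–(8.18)] -/
theorem shiftS_quarterGap (J : ℕ) :
    shiftS ![1, (J : ℝ) - 1 / 4, (J : ℝ) + 1 / 4] = ![2 * (J : ℝ), (J : ℝ) + 5 / 4, (J : ℝ) + 3 / 4] := by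
  funext j; fin_cases j <;> (simp [shiftS]; try ring)

/-- `n(1, J−¼, J+¼) = (J² − 1/16, J+¼, J−¼)`. [cite: Zhang2022LandauSiegel, §8 (8.13)–(8.18)] -/
theorem shiftN_quarterGap (J : ℕ) :
    shiftN ![1, (J : ℝ) - 1 / 4, (J : ℝ) + 1 / 4] = ![(J : ℝ) ^ 2 - 1 / 16, (J : ℝ) + 1 / 4, (J : ℝ) - 1 / 4] := by
  funext j; fin_cases j <;> (simp [shiftN]; try ring)

/-- `4J − 5 ≠ 0` and `4J − 3 ≠ 0` for a natural `J` (as reals). [folklore] -/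
private theorem four_mul_sub_ne (J : ℕ) : (4 * (J : ℝ) - 5 ≠ 0) ∧ (4 * (J : ℝ) - 3 ≠ 0) := by
  constructor
  · intro h
    have h2 : ((4 * J : ℕ) : ℝ) = 5 := by push_cast; linarith
    have h3 : 4 * J = 5 := by exact_mod_cast h2
    omega
  · intro h
    have h2 : ((4 * J : ℕ) : ℝ) = 3 := by push_cast; linarith
    have h3 : 4 * J = 3 := by exact_mod_cast h2
    omega

/-- **`W(1, J−¼, J+¼)`** in integer-denominator form: `W₀ = (16/((4J−5)(4J−3)))·(−i(−1)^J)`,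
`W₁ = (−2(4J−1)/(4J−5))·e^{3πi/4}`, `W₂ = (2(4J+1)/(4J−3))·e^{πi/4}`.
[cite: Zhang2022LandauSiegel, proof of Prop 7.1, (7.19)–(7.21)] -/
theorem shiftW_quarterGap (J : ℕ) :
    shiftW ![1, (J : ℝ) - 1 / 4, (J : ℝ) + 1 / 4] =
      ![(((16 / ((4 * (J : ℝ) - 5) * (4 * (J : ℝ) - 3))) : ℝ) : ℂ) * (-I * (-1) ^ J),
        (((-(2 * (4 * (J : ℝ) - 1)) / (4 * (J : ℝ) - 5)) : ℝ) : ℂ) *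
          (((-(Real.sqrt 2 / 2) : ℝ) : ℂ) + ((Real.sqrt 2 / 2 : ℝ) : ℂ) * I),
        (((2 * (4 * (J : ℝ) + 1) / (4 * (J : ℝ) - 3)) : ℝ) : ℂ) *
          (((Real.sqrt 2 / 2 : ℝ) : ℂ) + ((Real.sqrt 2 / 2 : ℝ) : ℂ) * I)] := by
  obtain ⟨h5, h3⟩ := four_mul_sub_ne J
  have h5c : (4 * (J : ℂ) - 5) ≠ 0 := by exact_mod_cast (show ((4 * (J : ℝ) - 5 : ℝ) : ℂ) ≠ 0 from
    Complex.ofReal_ne_zero.mpr h5)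
  have h3c : (4 * (J : ℂ) - 3) ≠ 0 := by exact_mod_cast (show ((4 * (J : ℝ) - 3 : ℝ) : ℂ) ≠ 0 from
    Complex.ofReal_ne_zero.mpr h3)
  funext j
  fin_cases j
  · simp only [shiftW, shiftS, shiftVdm]
    simp only [Fin.zero_eta, Fin.isValue, Matrix.cons_val_zero, Matrix.cons_val_one, Matrix.head_cons,
      Matrix.cons_val_two, Matrix.tail_cons]
    rw [show (((J : ℝ) - 1 / 4 + ((J : ℝ) + 1 / 4) - 1) / 2 : ℝ) = (J : ℝ) - 1 / 2 by ring, cexp_pi_mul_sub_half']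
    push_cast
    field_simp
    ring
  · simp only [shiftW, shiftS, shiftVdm]
    simp only [Fin.mk_one, Fin.isValue, Matrix.cons_val_zero, Matrix.cons_val_one, Matrix.head_cons,
      Matrix.cons_val_two, Matrix.tail_cons]
    rw [show ((((J : ℝ) + 1 / 4 + 1 - ((J : ℝ) - 1 / 4)) / 2 : ℝ)) = (3 / 4 : ℝ) by ring, cexp_three_quarters]
    push_cast
    rw [show ((J : ℂ) + 1 / 4 - ((J : ℂ) - 1 / 4)) * (1 - ((J : ℂ) - 1 / 4)) = -(4 * (J : ℂ) - 5) / 8 by ring]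
    field_simp
    ring
  · simp only [shiftW, shiftS, shiftVdm]
    simp only [Fin.reduceFinMk, Fin.isValue, Matrix.cons_val_zero, Matrix.cons_val_one, Matrix.head_cons,
      Matrix.cons_val_two, Matrix.tail_cons]
    rw [show (((1 + ((J : ℝ) - 1 / 4) - ((J : ℝ) + 1 / 4)) / 2 : ℝ)) = (1 / 4 : ℝ) by ring, cexp_quarter]
    push_cast
    rw [show (1 - ((J : ℂ) + 1 / 4)) * ((J : ℂ) - 1 / 4 - ((J : ℂ) + 1 / 4)) = (4 * (J : ℂ) - 3) / 8 by ring]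
    field_simp
    ring

/-! ## Even `J`: witness `k₁ + k_J` -/

/-- **THE `m = ¼` EDGE VALUE, EVEN `J ≥ 2`**: `FormDet (shiftRecipe (1, J−¼, J+¼)) (k₁ + k_J) =
−4 + 2√2 − (√2/4)·π·(1 + 1/(J(4J−5)(4J−3)))` (`J = 20`: lineage A's `−2.2823032…`).
[cite: Zhang2022LandauSiegel, Prop 7.1 p.44 with (8.11)–(8.23); §2 (2.13)] -/
theorem formDet_quarterGapEdge_even {J : ℕ} (hJ : Even J) (hJ2 : 2 ≤ J) :
    FormDet (shiftRecipe ![1, (J : ℝ) - 1 / 4, (J : ℝ) + 1 / 4]) (fun y => (1:ℂ) * afeDir 1 y + 1 * afeDir J y)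
        (fun y => (1:ℂ) * afeDir' 1 y + 1 * afeDir' J y) =
      -4 + 2 * Real.sqrt 2 - Real.sqrt 2 / 4 * π * (1 + 1 / ((J : ℝ) * (4 * J - 5) * (4 * J - 3))) := by
  have hJ1 : 1 < J := by omega
  have hJne : J ≠ 0 := by omega
  have hJm1 : J - 1 ≠ 0 := by omega
  have hpow : (-1 : ℂ) ^ J = 1 := hJ.neg_one_pow
  have hpow1 : (-1 : ℂ) ^ (J - 1) = -1 := by
    have h := pow_succ (-1 : ℂ) (J - 1)
    rw [Nat.sub_add_cancel hJ1.le, hpow] at h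
    linear_combination h
  have h1 : (1:ℂ) * (-1) ^ 1 + 1 * (-1) ^ J = 0 := by rw [hpow]; norm_num
  rw [formDet_recipe_twoTerm _ one_ne_zero hJ1 1 1 h1]
  simp only [shiftRecipe, shiftW_quarterGap, shiftS_quarterGap, shiftN_quarterGap, Fin.sum_univ_three]
  simp only [Fin.isValue, Matrix.cons_val_zero, Matrix.cons_val_one, Matrix.head_cons, Matrix.cons_val_two,
    Matrix.tail_cons]
  rw [hpow, hpow1]
  simp only [pow_one, div_eq_mul_inv, afeFreq_inv₁₈d one_ne_zero, afeFreq_inv₁₈d hJne, afeFreq_inv₁₈d hJm1]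
  simp only [afeFreq_eq₁₈d]
  have hcast : ((J - 1 : ℕ) : ℝ) = (J : ℝ) - 1 := by push_cast [Nat.cast_sub hJ1.le]; ring
  simp only [hcast]
  have hπ : π ≠ 0 := Real.pi_ne_zero
  have hJr : (J : ℝ) ≠ 0 := Nat.cast_ne_zero.mpr hJne
  have hJr1 : (J : ℝ) - 1 ≠ 0 := by
    have : (2:ℝ) ≤ J := by exact_mod_cast hJ2
    linarith
  obtain ⟨hJr4, hJr5⟩ := four_mul_sub_ne J
  simp only [map_add, map_mul, map_sub, map_neg, map_one, Complex.conj_ofReal, Complex.conj_I,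
    Complex.add_re, Complex.add_im, Complex.sub_re, Complex.sub_im, Complex.mul_re, Complex.mul_im,
    Complex.neg_re, Complex.neg_im, Complex.I_re, Complex.I_im, Complex.ofReal_re, Complex.ofReal_im,
    Complex.one_re, Complex.one_im]
  push_cast
  field_simp
  ring

/-! ## Odd `J`: witness `k₁ − k_J` -/

set_option maxHeartbeats 400000 in
/-- **THE `m = ¼` EDGE VALUE, ODD `J ≥ 3`**: `FormDet (shiftRecipe (1, J−¼, J+¼)) (k₁ − k_J) =
(−4 + 2√2)(1 + (2J−1)/(J²(4J−5)(4J−3))) − (√2/4)·π·(1 + 1/(J(4J−5)(4J−3)))` (`J = 3`: part 16's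
`−2288/567 + 1144√2/567 − (95√2/378)π`; `J = 5`: lineage A's `−2.2848187…`).
[cite: Zhang2022LandauSiegel, Prop 7.1 p.44 with (8.11)–(8.23); §2 (2.13)] -/
theorem formDet_quarterGapEdge_odd {J : ℕ} (hJ : Odd J) (hJ3 : 3 ≤ J) :
    FormDet (shiftRecipe ![1, (J : ℝ) - 1 / 4, (J : ℝ) + 1 / 4]) (fun y => (1:ℂ) * afeDir 1 y + (-1) * afeDir J y)
        (fun y => (1:ℂ) * afeDir' 1 y + (-1) * afeDir' J y) =
      (-4 + 2 * Real.sqrt 2) * (1 + (2 * J - 1) / ((J : ℝ) ^ 2 * (4 * J - 5) * (4 * J - 3)))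
        - Real.sqrt 2 / 4 * π * (1 + 1 / ((J : ℝ) * (4 * J - 5) * (4 * J - 3))) := by
  have hJ1 : 1 < J := by omega
  have hJne : J ≠ 0 := by omega
  have hJm1 : J - 1 ≠ 0 := by omega
  have hpow : (-1 : ℂ) ^ J = -1 := hJ.neg_one_pow
  have hpow1 : (-1 : ℂ) ^ (J - 1) = 1 := by
    have h := pow_succ (-1 : ℂ) (J - 1)
    rw [Nat.sub_add_cancel hJ1.le, hpow] at h
    linear_combination h
  have h1 : (1:ℂ) * (-1) ^ 1 + (-1) * (-1) ^ J = 0 := by rw [hpow]; norm_num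
  rw [formDet_recipe_twoTerm _ one_ne_zero hJ1 1 (-1) h1]
  simp only [shiftRecipe, shiftW_quarterGap, shiftS_quarterGap, shiftN_quarterGap, Fin.sum_univ_three]
  simp only [Fin.isValue, Matrix.cons_val_zero, Matrix.cons_val_one, Matrix.head_cons, Matrix.cons_val_two,
    Matrix.tail_cons]
  rw [hpow, hpow1]
  simp only [pow_one, div_eq_mul_inv, afeFreq_inv₁₈d one_ne_zero, afeFreq_inv₁₈d hJne, afeFreq_inv₁₈d hJm1]
  simp only [afeFreq_eq₁₈d]
  have hcast : ((J - 1 : ℕ) : ℝ) = (J : ℝ) - 1 := by push_cast [Nat.cast_sub hJ1.le]; ring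
  simp only [hcast]
  have hπ : π ≠ 0 := Real.pi_ne_zero
  have hJr : (J : ℝ) ≠ 0 := Nat.cast_ne_zero.mpr hJne
  have hJr1 : (J : ℝ) - 1 ≠ 0 := by
    have : (3:ℝ) ≤ J := by exact_mod_cast hJ3
    linarith
  obtain ⟨hJr4, hJr5⟩ := four_mul_sub_ne J
  simp only [map_add, map_mul, map_sub, map_neg, map_one, Complex.conj_ofReal, Complex.conj_I,
    Complex.add_re, Complex.add_im, Complex.sub_re, Complex.sub_im, Complex.mul_re, Complex.mul_im,
    Complex.neg_re, Complex.neg_im, Complex.I_re, Complex.I_im, Complex.ofReal_re, Complex.ofReal_im,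
    Complex.one_re, Complex.one_im]
  push_cast
  field_simp
  ring


end Det

end Literature.NumberTheory.LFunctions.Zhang2022
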